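import Literature.AnabelianGeometry.SemiGraphs.PSCSmoothCurveGenuineAllInputs
import Literature.AnabelianGeometry.SemiGraphs.PSCSmoothCurveGenuineCompactify
import Literature.AnabelianGeometry.SemiGraphs.PSCSmoothCurveGenuineMapAlong
import HarnessLib

/-!
# [CombGC] Theorem 1.6 (i)(ii)(iii) AS TYPED holds at the pro-`ℓ` genuine smooth-CURVE origin (capstone non-vacuity with cusps)

Mochizuki, *A combinatorial version of the Grothendieck conjecture* [CombGC], Tohoku Math. J. **59**
(2007), Theorem 1.6 p. 13 ("(i) `α` is numerically cuspidal if and only if it is group-theoretically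
cuspidal. (ii) `α` is graphic if and only if it is graphically filtration-preserving. (iii) `β` is
verticially filtration-preserving if and only if it is group-theoretically verticial."), with its §1
inputs Def. 1.1 / Rmk. 1.1.3 / Rmk. 1.1.5 / Rmk. 1.1.6 / Prop. 1.2 / Prop. 1.3 / Prop. 1.5 (pp. 6–13) and
the replacement texts [IUTchI] Rmk. 1.2.3 (iv)(v) (pp. 41–43). [cite: MochizukiCombGC2007, Thm 1.6 p.13]
[cite: MochizukiCombGC2007, §1 pp.6-14] [cite: Mochizuki2012, IUTchI Rmk 1.2.3(v) p.43]

PROOF-ONLY capstone assembly (abc-iut cell, layer L3, L-F sub-cell [SemiAnbd]+[CombGC] pack C, row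
«THM16-CAPSTONE@SC-GENUINE», seat abc-iut-w5-d174 gen 5; the smooth-CURVE twin of abc-iut-w5-d183's
`exists_smoothProperGenuineOrigin_thm16_inputs_hold` in `PSCThm16InputsSmoothProperGenuine.lean`).
The capstone `thm16_holds_of_inputs` (`PSCThm16CapstoneProofs.lean`) derives the three typed statements
of Thm. 1.6 at an origin `Ω` from profiniteness and THIRTEEN origin statements consumed by name.  At
abc-iut-w5-d195's covering-closed pro-`ℓ` GENUINE smooth-curve origin `Ω_scg^{(ℓ)}` (data: profinite
`Π`, no nodes, one vertex `Π_v = Π` of genus `g`, `Σ = {ℓ}`, a pro-`Σ` completion `ι : Γ_{g,r} → Π` of a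
hyperbolic punctured surface group, cusp groups ANY conjugates of the closed cusp inertia groups
`closure ι⟨c_j⟩`) every one of the thirteen is now a theorem of the tree:
`RankStatementsHold` (abc-iut-w5-d195, `rankStatementsHold_of_smoothCurveGenuine`),
`CuspidalEdgeLikeCharacterizationHolds` (`…_of_smoothCurve'`), `NodalEdgeLikeCharacterizationHolds`
(this file: the `IsNoncuspidal` guard of [IUTchI] Rmk. 1.2.3 (v) forces `r = 0` at a no-node datum, where
abc-iut-L3-t4's `nodalEdgeLikeCharacterization_of_isEmpty` applies), `CompactifyOfPSCTypeHolds`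
(abc-iut-w5-d174, `compactifyOfPSCTypeHolds_of_smoothCurveGenuine`), `RestrictBDOfPSCTypeHolds`
(`restrict_smoothCurveGenuine`), `SturdyCoverHolds` (`…_singleton`), `OpenInterDeterminesComponentHolds` /
`CommensurableTerminalityHolds` / `GraphicIffEdgeLikeVerticialHolds` (`…_of_smoothCurve'`),
`UnrVerticialCharacterizationHolds'` / `VertCountLeNodeCountSuccHolds` (`…_of_vertGp_eq_top`),
`UnrVertAbOfRankHolds` (`…_of_smoothCurveGenuine`), `MapAlongProLOfPSCTypeHolds` (abc-iut-w5-d174,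
`mapAlongProLOfPSCTypeHolds_of_smoothCurveGenuine`).  Hence:

* `nodalEdgeLikeCharacterization_of_isEmpty_nodes`, `nodalEdgeLikeCharacterizationHolds_of_isEmpty_nodes`
  — [IUTchI] Rmk. 1.2.3 (v) AS TYPED at every datum / origin without nodes;
* `thm16_inputs_hold_of_smoothCurveGenuine (ℓ) (hℓ) (Ω) (hout) (hin)` — for every origin whose membership
  predicate is (both ways) the pro-`ℓ` genuine smooth-curve shape: profiniteness, the thirteen inputs,
  and `NumericallyCuspidalIffHolds Ω ∧ GraphicIffFiltrationPreservingHolds Ω ∧ UnrVerticialIffHolds Ω`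
  through `thm16_holds_of_inputs`;
* `exists_smoothCurveGenuineProLOrigin_thm16_inputs_hold (ℓ) (hℓ)` — the origin itself (verbatim the
  `let Ω` of `exists_smoothCurveGenuineProLOrigin_allInputs_hold`), inhabited by the pro-`ℓ` smooth curve
  of every hyperbolic type `(g, r)`, with all of the above.

0 definitions.  Consistency / non-vacuity evidence for the capstone at genuine one-component data WITH
CUSPS and all their finite étale coverings, compactifications and pro-`ℓ` images; not the printed theorems
for all pointed stable curves (the thirteen inputs remain FACT rows / origin statements elsewhere); nothing
here takes a side on [IUTchIII] Cor. 3.12.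
-/

noncomputable section

namespace Literature.AnabelianGeometry.SemiGraphs

namespace PSCDatum

open scoped Pointwise
open Literature.GroupTheory.CombinatorialGroupTheory
open Literature.GroupTheory.CombinatorialGroupTheory.PuncturedSurfaceGroup (cuspInertia IsHyperbolicType)
open SemiGraphOfAnabelioids (IsProSigmaCompletion)
open SemiGraphOfAnabelioids.IsProSigmaCompletion (exists_isProSigmaCompletion)

universe u

variable {P : Type u} [Group P] [TopologicalSpace P] [IsTopologicalGroup P]

/-! ### [IUTchI] Rmk. 1.2.3 (v) at data without nodes -/

/-- **[IUTchI] Rmk. 1.2.3 (v) AS TYPED at a datum without nodes.**  The typed statement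
`NodalEdgeLikeCharacterization` is guarded by "`G` noncuspidal" (`r(G) = 0`); at a datum with no nodes
this guard leaves only the smooth-proper shape (no nodes, no cusps), where abc-iut-L3-t4's
`nodalEdgeLikeCharacterization_of_isEmpty` proves it (no subgroup is nodal, none satisfies the ramification
condition, and `U ⊆ A·U` is neither nodally totally ramified nor module-wise nodal).
[cite: Mochizuki2012, IUTchI Rmk 1.2.3(v) p.43] -/
theorem nodalEdgeLikeCharacterization_of_isEmpty_nodes (G : PSCDatum P) [IsEmpty G.graph.N] :
    G.NodalEdgeLikeCharacterization := fun hnc =>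
  haveI : IsEmpty G.graph.C := Fintype.card_eq_zero_iff.mp hnc
  G.nodalEdgeLikeCharacterization_of_isEmpty hnc

/-- **`NodalEdgeLikeCharacterizationHolds Ω` at every origin of data without nodes** (in particular at
every genuine smooth-curve origin, with or without cusps). [cite: Mochizuki2012, IUTchI Rmk 1.2.3(v) p.43] -/
theorem nodalEdgeLikeCharacterizationHolds_of_isEmpty_nodes (Ω : PSCOrigin.{u})
    (hΩ : ∀ ⦃Q : Type u⦄ [Group Q] [TopologicalSpace Q] (G : PSCDatum Q), Ω.IsOfPSCType G →
      IsEmpty G.graph.N) :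
    NodalEdgeLikeCharacterizationHolds Ω := by
  intro Q _ _ _ G hG
  haveI := hΩ G hG
  exact G.nodalEdgeLikeCharacterization_of_isEmpty_nodes

/-! ### The thirteen capstone inputs and Thm. 1.6 (i)(ii)(iii) at a pro-`ℓ` genuine smooth-curve origin -/

/-- **The thirteen inputs of `thm16_holds_of_inputs`, and through it [CombGC] Thm. 1.6 (i) ∧ (ii) ∧ (iii)
AS TYPED, hold at every pro-`ℓ` genuine smooth-curve origin.**  Let `ℓ` be prime and let the membership
predicate of `Ω` be, in both directions (`hout`, `hin`), the pro-`ℓ` genuine smooth-curve shape (verbatim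
the `let Ω` of abc-iut-w5-d195's `exists_smoothCurveGenuineProLOrigin_allInputs_hold`).  Then the data of
`Ω` are profinite and `Ω` satisfies `RankStatementsHold`, `CuspidalEdgeLikeCharacterizationHolds`,
`NodalEdgeLikeCharacterizationHolds`, `CompactifyOfPSCTypeHolds`, `RestrictBDOfPSCTypeHolds`,
`SturdyCoverHolds`, `OpenInterDeterminesComponentHolds`, `CommensurableTerminalityHolds`,
`GraphicIffEdgeLikeVerticialHolds`, `UnrVerticialCharacterizationHolds'`, `UnrVertAbOfRankHolds`,
`VertCountLeNodeCountSuccHolds`, `MapAlongProLOfPSCTypeHolds`, hence (capstone `thm16_holds_of_inputs`)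
`NumericallyCuspidalIffHolds Ω ∧ GraphicIffFiltrationPreservingHolds Ω ∧ UnrVerticialIffHolds Ω`:
"(i) `α` is numerically cuspidal iff group-theoretically cuspidal; (ii) `α` is graphic iff graphically
filtration-preserving; (iii) `β` is verticially filtration-preserving iff group-theoretically verticial"
for all `G`, `H` of `Ω`-type and all `α`, `β`. [cite: MochizukiCombGC2007, Thm 1.6 p.13] -/
theorem thm16_inputs_hold_of_smoothCurveGenuine (ℓ : ℕ) (hℓ : ℓ.Prime) (Ω : PSCOrigin.{u})
    (hout : ∀ ⦃Q : Type u⦄ [Group Q] [TopologicalSpace Q] (G : PSCDatum Q), Ω.IsOfPSCType G →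
      ∃ (_ : IsTopologicalGroup Q), CompactSpace Q ∧ T2Space Q ∧
        TotallyDisconnectedSpace Q ∧ IsEmpty G.graph.N ∧ (∀ v, G.vertGp v = ⊤) ∧
        (∃ v₀ : G.graph.V, ∀ w, w = v₀) ∧ G.Sigma = {ℓ} ∧
        ∃ (g r : ℕ) (ι : PuncturedSurfaceGroup g r →* Q) (e : G.graph.C ≃ Fin r),
          IsHyperbolicType g r ∧ IsProSigmaCompletion G.Sigma ι ∧ (∀ v, G.genus v = g) ∧
          ∀ c, ∃ δ : ConjAct Q, G.cuspGp c = δ • ((cuspInertia (g := g) (e c)).map ι).topologicalClosure)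
    (hin : ∀ ⦃Q : Type u⦄ [Group Q] [TopologicalSpace Q] (G : PSCDatum Q),
      (∃ (_ : IsTopologicalGroup Q), CompactSpace Q ∧ T2Space Q ∧
        TotallyDisconnectedSpace Q ∧ IsEmpty G.graph.N ∧ (∀ v, G.vertGp v = ⊤) ∧
        (∃ v₀ : G.graph.V, ∀ w, w = v₀) ∧ G.Sigma = {ℓ} ∧
        ∃ (g r : ℕ) (ι : PuncturedSurfaceGroup g r →* Q) (e : G.graph.C ≃ Fin r),
          IsHyperbolicType g r ∧ IsProSigmaCompletion G.Sigma ι ∧ (∀ v, G.genus v = g) ∧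
          ∀ c, ∃ δ : ConjAct Q, G.cuspGp c =
            δ • ((cuspInertia (g := g) (e c)).map ι).topologicalClosure) → Ω.IsOfPSCType G) :
    (∀ ⦃Q : Type u⦄ [Group Q] [TopologicalSpace Q] [IsTopologicalGroup Q] (K : PSCDatum Q),
        Ω.IsOfPSCType K → CompactSpace Q ∧ TotallyDisconnectedSpace Q) ∧
      RankStatementsHold Ω ∧ CuspidalEdgeLikeCharacterizationHolds Ω ∧
      NodalEdgeLikeCharacterizationHolds Ω ∧ CompactifyOfPSCTypeHolds Ω ∧ RestrictBDOfPSCTypeHolds Ω ∧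
      SturdyCoverHolds Ω ∧ OpenInterDeterminesComponentHolds Ω ∧ CommensurableTerminalityHolds Ω ∧
      GraphicIffEdgeLikeVerticialHolds Ω ∧ UnrVerticialCharacterizationHolds' Ω ∧ UnrVertAbOfRankHolds Ω ∧
      VertCountLeNodeCountSuccHolds Ω ∧ MapAlongProLOfPSCTypeHolds Ω ∧
      (Literature.AnabelianGeometry.SemiGraphs.PSCDatum.NumericallyCuspidalIffHolds Ω ∧
        Literature.AnabelianGeometry.SemiGraphs.PSCDatum.GraphicIffFiltrationPreservingHolds Ω ∧
          Literature.AnabelianGeometry.SemiGraphs.PSCDatum.UnrVerticialIffHolds Ω) := by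
  -- the hypothesis shapes of the origin-level lemmas, read off `hout`
  have hΩ₁ : ∀ ⦃Q : Type u⦄ [Group Q] [TopologicalSpace Q] [IsTopologicalGroup Q] (G : PSCDatum Q),
      Ω.IsOfPSCType G → CompactSpace Q ∧ T2Space Q ∧ TotallyDisconnectedSpace Q ∧ IsEmpty G.graph.N ∧
        (∀ v, G.vertGp v = ⊤) ∧ (∃ v₀ : G.graph.V, ∀ w, w = v₀) ∧
        ∃ (S : Set ℕ) (g r : ℕ) (ι : PuncturedSurfaceGroup g r →* Q) (e : G.graph.C ≃ Fin r),
          S.Nonempty ∧ (∀ p ∈ S, p.Prime) ∧ IsHyperbolicType g r ∧ IsProSigmaCompletion S ι ∧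
          ∀ c, ∃ δ : ConjAct Q, G.cuspGp c =
            δ • ((cuspInertia (g := g) (e c)).map ι).topologicalClosure := by
    intro Q _ _ _ G hG
    obtain ⟨_, hc, ht, hd, hN, hV, hv, -, g, r, ι, e, hgr, hι, -, hC⟩ := hout G hG
    exact ⟨hc, ht, hd, hN, hV, hv, G.Sigma, g, r, ι, e, G.sigma_nonempty, G.sigma_prime, hgr, hι, hC⟩
  have hΩ₁' : ∀ ⦃Q : Type u⦄ [Group Q] [TopologicalSpace Q] [IsTopologicalGroup Q] (G : PSCDatum Q),
      Ω.IsOfPSCType G → CompactSpace Q ∧ T2Space Q ∧ TotallyDisconnectedSpace Q ∧ IsEmpty G.graph.N ∧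
        (∃ v₀ : G.graph.V, ∀ w, w = v₀) ∧
        ∃ (S : Set ℕ) (g r : ℕ) (ι : PuncturedSurfaceGroup g r →* Q) (e : G.graph.C ≃ Fin r),
          S.Nonempty ∧ (∀ p ∈ S, p.Prime) ∧ IsHyperbolicType g r ∧ IsProSigmaCompletion S ι ∧
          ∀ c, ∃ δ : ConjAct Q, G.cuspGp c =
            δ • ((cuspInertia (g := g) (e c)).map ι).topologicalClosure := fun Q _ _ _ G hG => by
    obtain ⟨h1, h2, h3, h4, -, h6, h7⟩ := hΩ₁ G hG
    exact ⟨h1, h2, h3, h4, h6, h7⟩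
  have hΩ₂ : ∀ ⦃Q : Type u⦄ [Group Q] [TopologicalSpace Q] (G : PSCDatum Q), Ω.IsOfPSCType G →
      IsEmpty G.graph.N ∧ (∀ v, G.vertGp v = ⊤) ∧ Nonempty G.graph.V := by
    intro Q _ _ G hG
    obtain ⟨_, -, -, -, hN, hV, ⟨v₀, -⟩, -⟩ := hout G hG
    exact ⟨hN, hV, ⟨v₀⟩⟩
  have hΩv : ∀ ⦃Q : Type u⦄ [Group Q] [TopologicalSpace Q] (G : PSCDatum Q), Ω.IsOfPSCType G →
      (∀ v, G.vertGp v = ⊤) ∧ ∃ v₀ : G.graph.V, ∀ w, w = v₀ := by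
    intro Q _ _ G hG
    obtain ⟨_, -, -, -, -, hV, hv, -⟩ := hout G hG
    exact ⟨hV, hv⟩
  have hprof : ∀ ⦃Q : Type u⦄ [Group Q] [TopologicalSpace Q] [IsTopologicalGroup Q] (K : PSCDatum Q),
      Ω.IsOfPSCType K → CompactSpace Q ∧ TotallyDisconnectedSpace Q := by
    intro Q _ _ _ K hK
    obtain ⟨_, hc, -, hd, -⟩ := hout K hK
    exact ⟨hc, hd⟩
  -- the thirteen origin statements
  have hrank : RankStatementsHold Ω :=
    rankStatementsHold_of_smoothCurveGenuine Ω fun Q _ _ _ G hG => by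
      obtain ⟨_, hc, ht, hd, hN, hV, hv, -, g, r, ι, e, hgr, hι, hgen, hC⟩ := hout G hG
      exact ⟨hc, ht, hd, hN, hV, hv, g, r, ι, e, hgr, hι, hgen, hC⟩
  have hcusp : CuspidalEdgeLikeCharacterizationHolds Ω :=
    cuspidalEdgeLikeCharacterizationHolds_of_smoothCurve' Ω hΩ₁'
  have hnodal : NodalEdgeLikeCharacterizationHolds Ω :=
    nodalEdgeLikeCharacterizationHolds_of_isEmpty_nodes Ω fun Q _ _ G hG => (hΩ₂ G hG).1
  have hcpt : CompactifyOfPSCTypeHolds Ω := compactifyOfPSCTypeHolds_of_smoothCurveGenuine ℓ Ω hout hin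
  have hres : RestrictBDOfPSCTypeHolds Ω := by
    intro Q _ _ _ H hH
    obtain ⟨_, hc, ht, hd, hN, hV, ⟨v₀, hv⟩, hS, g, r, ι, e, hgr, hι, hgen, hC⟩ := hout H hH
    refine ⟨H.chosenBranchData, fun U _ hU => ?_⟩
    rw [restrictBD_chosen]
    haveI : CompactSpace U := isCompact_iff_compactSpace.mp (U.isClosed_of_isOpen hU).isCompact
    obtain ⟨hN', hV', hv', g', r', ι', e', h', hι', -, hgen', hC'⟩ :=
      H.restrict_smoothCurveGenuine U hU hV v₀ hv hgr ι hι e hC hgen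
    exact hin _ ⟨inferInstance, inferInstance, inferInstance, inferInstance, hN', hV', hv', hS, g', r', ι',
      e', h', hι', hgen', hC'⟩
  have hcover : SturdyCoverHolds Ω :=
    sturdyCoverHolds_of_smoothCurveGenuine_singleton Ω fun Q _ _ _ G hG => by
      obtain ⟨_, hc, ht, hd, hN, hV, hv, hS, g, r, ι, e, hgr, hι, hgen, hC⟩ := hout G hG
      exact ⟨hc, ht, hd, hN, hV, hv, ⟨ℓ, hℓ, hS⟩, g, r, ι, e, hgr, hι, hgen, hC⟩
  have hopen : OpenInterDeterminesComponentHolds Ω := openInterDeterminesComponentHolds_of_smoothCurve' Ω hΩ₁'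
  have hCT : CommensurableTerminalityHolds Ω := commensurableTerminalityHolds_of_smoothCurve' Ω hΩ₁
  have hP15 : GraphicIffEdgeLikeVerticialHolds Ω := graphicIffEdgeLikeVerticialHolds_of_smoothCurve' Ω hΩ₁ hΩ₂
  have hunr : UnrVerticialCharacterizationHolds' Ω := unrVerticialCharacterizationHolds'_of_vertGp_eq_top Ω hΩv
  have hrankv : UnrVertAbOfRankHolds Ω :=
    unrVertAbOfRankHolds_of_smoothCurveGenuine Ω fun Q _ _ _ G hG => by
      obtain ⟨_, -, ht, -, hN, hV, -, -, g, r, ι, e, -, hι, hgen, hC⟩ := hout G hG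
      exact ⟨ht, hN, hV, g, r, ι, e, hι, hgen, hC⟩
  have hconn : VertCountLeNodeCountSuccHolds Ω := vertCountLeNodeCountSuccHolds_of_vertGp_eq_top Ω hΩv
  have hmap : MapAlongProLOfPSCTypeHolds Ω := mapAlongProLOfPSCTypeHolds_of_smoothCurveGenuine ℓ Ω hout hin
  exact ⟨hprof, hrank, hcusp, hnodal, hcpt, hres, hcover, hopen, hCT, hP15, hunr, hrankv, hconn, hmap,
    thm16_holds_of_inputs Ω hprof hrank hcusp hnodal hcpt hres hcover hopen hCT hP15 hunr hrankv hconn hmap⟩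

/-- **THE PRO-`ℓ` GENUINE SMOOTH-CURVE ORIGIN CARRIES THE CAPSTONE: [CombGC] Thm. 1.6 (i) ∧ (ii) ∧ (iii) AS
TYPED, with all thirteen inputs, at genuine curves WITH CUSPS.**  For every prime `ℓ` there is an origin
`Ω` (the `let Ω` of abc-iut-w5-d195's `exists_smoothCurveGenuineProLOrigin_allInputs_hold`: profinite
carrier, no nodes, one vertex `Π_v = Π` of genus `g`, `Σ = {ℓ}`, a pro-`ℓ` completion `ι : Γ_{g,r} → Π`
with `(g, r)` hyperbolic, cusp groups conjugates of `closure ι⟨c_j⟩`), inhabited by the pro-`ℓ` smooth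
curve of EVERY hyperbolic type `(g, r)` (so for `r ≥ 1` by data with cusps), whose data are profinite and
which satisfies the thirteen named inputs of `thm16_holds_of_inputs` and hence
`NumericallyCuspidalIffHolds Ω ∧ GraphicIffFiltrationPreservingHolds Ω ∧ UnrVerticialIffHolds Ω`.
Consistency / non-vacuity evidence; not the printed theorems for all pointed stable curves.
[cite: MochizukiCombGC2007, Thm 1.6 p.13] -/
theorem exists_smoothCurveGenuineProLOrigin_thm16_inputs_hold (ℓ : ℕ) (hℓ : ℓ.Prime) :
    ∃ Ω : PSCOrigin.{0},
      (∀ (g r : ℕ), IsHyperbolicType g r →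
        ∃ (Q : ProfiniteGrp.{0}) (ι : PuncturedSurfaceGroup g r →* Q) (G : PSCDatum Q),
          IsProSigmaCompletion {ℓ} ι ∧ Ω.IsOfPSCType G ∧ G.Sigma = {ℓ} ∧ G.graph.i = 1 ∧ G.graph.n = 0 ∧
            G.graph.r = r ∧ (∀ v, G.vertGp v = ⊤ ∧ G.genus v = g) ∧
            ∃ e : G.graph.C ≃ Fin r, ∀ c, G.cuspGp c =
              ((cuspInertia (g := g) (e c)).map ι).topologicalClosure) ∧
      (∀ ⦃Q : Type⦄ [Group Q] [TopologicalSpace Q] [IsTopologicalGroup Q] (K : PSCDatum Q),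
          Ω.IsOfPSCType K → CompactSpace Q ∧ TotallyDisconnectedSpace Q) ∧
      RankStatementsHold Ω ∧ CuspidalEdgeLikeCharacterizationHolds Ω ∧
      NodalEdgeLikeCharacterizationHolds Ω ∧ CompactifyOfPSCTypeHolds Ω ∧ RestrictBDOfPSCTypeHolds Ω ∧
      SturdyCoverHolds Ω ∧ OpenInterDeterminesComponentHolds Ω ∧ CommensurableTerminalityHolds Ω ∧
      GraphicIffEdgeLikeVerticialHolds Ω ∧ UnrVerticialCharacterizationHolds' Ω ∧ UnrVertAbOfRankHolds Ω ∧
      VertCountLeNodeCountSuccHolds Ω ∧ MapAlongProLOfPSCTypeHolds Ω ∧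
      (Literature.AnabelianGeometry.SemiGraphs.PSCDatum.NumericallyCuspidalIffHolds Ω ∧
        Literature.AnabelianGeometry.SemiGraphs.PSCDatum.GraphicIffFiltrationPreservingHolds Ω ∧
          Literature.AnabelianGeometry.SemiGraphs.PSCDatum.UnrVerticialIffHolds Ω) := by
  -- verbatim the `let Ω` of `exists_smoothCurveGenuineProLOrigin_allInputs_hold` (abc-iut-w5-d195)
  let Ω : PSCOrigin.{0} :=
    ⟨fun {Q} _ _ G => ∃ (_ : IsTopologicalGroup Q), CompactSpace Q ∧ T2Space Q ∧
      TotallyDisconnectedSpace Q ∧ IsEmpty G.graph.N ∧ (∀ v, G.vertGp v = ⊤) ∧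
      (∃ v₀ : G.graph.V, ∀ w, w = v₀) ∧ G.Sigma = {ℓ} ∧
      ∃ (g r : ℕ) (ι : PuncturedSurfaceGroup g r →* Q) (e : G.graph.C ≃ Fin r),
        IsHyperbolicType g r ∧ IsProSigmaCompletion G.Sigma ι ∧ (∀ v, G.genus v = g) ∧
        ∀ c, ∃ δ : ConjAct Q, G.cuspGp c = δ • ((cuspInertia (g := g) (e c)).map ι).topologicalClosure⟩
  have h := thm16_inputs_hold_of_smoothCurveGenuine ℓ hℓ Ω (fun Q _ _ G hG => hG) (fun Q _ _ G hG => hG)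
  refine ⟨Ω, fun g r hgr => ?_, h⟩
  -- inhabitation: the pro-`ℓ` smooth curve of type `(g, r)` (adapted from abc-iut-w5-d195's
  -- `exists_smoothCurveGenuineProLOrigin_holds`)
  obtain ⟨Q, η, hη⟩ := exists_isProSigmaCompletion (PuncturedSurfaceGroup g r) ({ℓ} : Set ℕ)
  let T : PSCDatum Q :=
    { Sigma := {ℓ}
      sigma_prime := fun p hp => by rw [Set.mem_singleton_iff.mp hp]; exact hℓ
      sigma_nonempty := ⟨ℓ, Set.mem_singleton ℓ⟩
      graph := { V := Unit, N := Empty, C := Fin r, nodeEnds := Empty.elim, cuspEnd := fun _ => () }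
      vertGp := fun _ => ⊤
      nodeGp := Empty.elim
      cuspGp := fun i => ((cuspInertia (g := g) i).map η).topologicalClosure
      genus := fun _ => g
      isClosed_vertGp := fun _ => by rw [Subgroup.coe_top]; exact isClosed_univ
      isClosed_nodeGp := fun e => e.elim
      isClosed_cuspGp := fun _ => Subgroup.isClosed_topologicalClosure _
      nodeGp_le := fun e => e.elim
      cuspGp_le := fun _ => ⟨1, le_top⟩
      proSigma := isProSigma_of_isProSigmaCompletion hη }
  have hT : Ω.IsOfPSCType T :=
    ⟨inferInstance, inferInstance, inferInstance, inferInstance, inferInstanceAs (IsEmpty Empty),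
      fun _ => rfl, ⟨(), fun _ => rfl⟩, rfl, g, r, η, Equiv.refl _, hgr, hη, fun _ => rfl,
      fun c => ⟨1, by rw [one_smul]; rfl⟩⟩
  exact ⟨Q, η, T, hη, hT, rfl, rfl, rfl, Fintype.card_fin r, fun _ => ⟨rfl, rfl⟩, Equiv.refl _,
    fun _ => rfl⟩

end PSCDatum

end Literature.AnabelianGeometry.SemiGraphs

end
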